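import Mathlib
import HarnessLib
import Literature.NumberTheory.Sieve.IwaniecAlmostPrimesProp1Corollary
import Literature.NumberTheory.Sieve.IwaniecAlmostPrimesMertens
import Literature.NumberTheory.Sieve.IwaniecAlmostPrimesWeightedSum
import Summits.Parity.BatemanHorn.Theses.IsogenyRedei

/-!
# Route IsogenyRedei — the WALL LEMMA with Chebyshev's constant (item stmt-Parity-11618)

Quantitative companion of `IsogenyRedeiWallLemmaMass.lean`: the classical Chebyshev–Markov–Hooley
mass bound for `t² + 1`, with its explicit constant.  Main statements:
`isogenyRedei_wallLemma_card_largePrimeFactor_le` (`#{t ≤ x : some prime p ∣ t²+1, p > x^{1+ε}}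
≤ x/(1+ε) + C·x/log x`), and for every `ε, δ > 0` eventually `(ε/(1+ε) − δ)·x ≤ #{t ≤ x : P⁺(t²+1)
≤ x^{1+ε}}` (`…_friable_density_ge`) and `(ε/(1+ε) − δ)·x ≤ #{t ≤ x : every p ∣ t²+1 has
p·x^{1-ε} < t²+1}` (`…_dominantFree_density_ge`, the item's dominant-free = split-block class;
its conjectural density is the Dickman mass `1 − log(2/(1+ε))`, Martin 2002 under Hypothesis UH).

Argument (Chebyshev 1895/Markov; Hooley, Acta Math. 117 (1967) §2): with
`s_x(t) := Σ_{p ∣ t²+1 prime, p ≤ x} log p`, exchanging summations and using Mertens' theorem for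
the roots `ρ(p)` of `ν² + 1 ≡ 0 (mod p)` (tree: `Iwaniec1978.RhoMertensStrong_holds`), the trivial
remainder estimate `|r(x; p)| ≤ ρ(p)` (tree: `Iwaniec1978.abs_rem_le_rho`), `ρ(p) ≤ 2` and
`θ(x) ≤ x log 4` (Mathlib) gives `Σ_{t ≤ x} s_x(t) ≥ x log x − C₁x`; while `s_x(t) ≤ 2 log x + log 2`
always and `s_x(t) ≤ (1−ε) log x + log 2` whenever a prime `q > x^{1+ε}` divides `t²+1`, or `t²+1`
is dominant (`q·x^{1-ε} ≥ t²+1`) with `t²+1 > x^{2-ε}`.  Counting gives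
`#B·(1+ε) log x ≤ x log x + (C₁ + log 2)x` for any set `B` of such `t`.
-/


namespace Summit.Parity.BatemanHorn.Theorems

open Finset Real Filter
open scoped Classical Topology
open Literature.NumberTheory.Sieve.Iwaniec1978

/-- If `(∏_{p ∈ S} p)·m ∣ t² + 1`, where `S` is the set of primes `p ≤ x` dividing `t² + 1` and
`m ≥ 1`, then the smooth log-mass `s_x(t) = Σ_{p ∈ S} log p` is at most `log(t² + 1) − log m`.
[folklore] -/
theorem isogenyRedei_wallLemma_smoothLogMass_le_of_dvd {x t m : ℕ} (hm : 0 < m)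
    (hdvd : (∏ p ∈ (t ^ 2 + 1).primeFactors.filter (· ≤ x), p) * m ∣ t ^ 2 + 1) :
    ∑ p ∈ (t ^ 2 + 1).primeFactors.filter (· ≤ x), Real.log ((p : ℕ) : ℝ) ≤
      Real.log ((t : ℝ) ^ 2 + 1) - Real.log m := by
  set S := (t ^ 2 + 1).primeFactors.filter (· ≤ x) with hS
  have hle : ((∏ p ∈ S, p : ℕ) : ℝ) * m ≤ (t : ℝ) ^ 2 + 1 :=
    mod_cast Nat.le_of_dvd (Nat.succ_pos _) hdvd
  have hpos : ∀ p ∈ S, (0 : ℝ) < (p : ℝ) := fun p hp => by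
    exact_mod_cast (Nat.prime_of_mem_primeFactors (Finset.mem_filter.mp hp).1).pos
  have hprodpos : (0 : ℝ) < ((∏ p ∈ S, p : ℕ) : ℝ) := by
    rw [Nat.cast_prod]; exact Finset.prod_pos hpos
  have hmpos : (0 : ℝ) < m := by exact_mod_cast hm
  have ht0 : (0 : ℝ) < (t : ℝ) ^ 2 + 1 := by positivity
  have h1 : ∑ p ∈ S, Real.log ((p : ℕ) : ℝ) = Real.log ((∏ p ∈ S, p : ℕ) : ℝ) := by
    rw [Nat.cast_prod, Real.log_prod fun p hp => (hpos p hp).ne']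
  rw [h1, ← Real.log_div ht0.ne' hmpos.ne']
  refine Real.log_le_log hprodpos ?_
  rw [le_div_iff₀ hmpos]
  exact hle

/-- `s_x(t) ≤ log(t² + 1)`: the primes `p ≤ x` dividing `t² + 1` have product dividing `t² + 1`.
[folklore] -/
theorem isogenyRedei_wallLemma_smoothLogMass_le_log (x t : ℕ) :
    ∑ p ∈ (t ^ 2 + 1).primeFactors.filter (· ≤ x), Real.log ((p : ℕ) : ℝ) ≤
      Real.log ((t : ℝ) ^ 2 + 1) := by
  have h := isogenyRedei_wallLemma_smoothLogMass_le_of_dvd (x := x) (t := t) Nat.one_pos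
    (by rw [mul_one]; exact (Finset.prod_dvd_prod_of_subset _ _ (fun p => p)
      (Finset.filter_subset _ _)).trans (Nat.prod_primeFactors_dvd _))
  simpa using h

/-- If a prime `q > x` divides `t² + 1`, then `s_x(t) ≤ log(t² + 1) − log q`: the primes `p ≤ x`
dividing `t² + 1` are coprime to `q`, so their product times `q` divides `t² + 1`. [folklore] -/
theorem isogenyRedei_wallLemma_smoothLogMass_le_of_large_prime {x t q : ℕ}
    (hq : q ∈ (t ^ 2 + 1).primeFactors) (hxq : x < q) :
    ∑ p ∈ (t ^ 2 + 1).primeFactors.filter (· ≤ x), Real.log ((p : ℕ) : ℝ) ≤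
      Real.log ((t : ℝ) ^ 2 + 1) - Real.log q := by
  have hqP : q.Prime := Nat.prime_of_mem_primeFactors hq
  refine isogenyRedei_wallLemma_smoothLogMass_le_of_dvd hqP.pos ?_
  have hSd : ∏ p ∈ (t ^ 2 + 1).primeFactors.filter (· ≤ x), p ∣ t ^ 2 + 1 :=
    (Finset.prod_dvd_prod_of_subset _ _ (fun p => p) (Finset.filter_subset _ _)).trans
      (Nat.prod_primeFactors_dvd _)
  have hcop : Nat.Coprime (∏ p ∈ (t ^ 2 + 1).primeFactors.filter (· ≤ x), p) q := by
    refine Nat.Coprime.prod_left fun p hp => ?_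
    have hp' := Finset.mem_filter.mp hp
    have hne : p ≠ q := by
      rintro rfl
      exact absurd hp'.2 (not_le.mpr hxq)
    exact (Nat.coprime_primes (Nat.prime_of_mem_primeFactors hp'.1) hqP).mpr hne
  exact hcop.mul_dvd_of_dvd_of_dvd hSd (Nat.dvd_of_mem_primeFactors hq)

/-- Exchange of summation: `Σ_{1 ≤ t ≤ x} s_x(t) = Σ_{p ≤ x prime} log p · #{1 ≤ t ≤ x : p ∣ t²+1}`.
[folklore] -/
theorem isogenyRedei_wallLemma_sum_smoothLogMass_eq (x : ℕ) :
    ∑ t ∈ Finset.Icc 1 x, ∑ p ∈ (t ^ 2 + 1).primeFactors.filter (· ≤ x), Real.log ((p : ℕ) : ℝ) =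
      ∑ p ∈ Nat.primesLE x, Real.log ((p : ℕ) : ℝ) *
        (((Finset.Icc 1 x).filter fun t : ℕ => p ∣ t ^ 2 + 1).card : ℝ) := by
  have hinner : ∀ t ∈ Finset.Icc 1 x,
      ∑ p ∈ (t ^ 2 + 1).primeFactors.filter (· ≤ x), Real.log ((p : ℕ) : ℝ) =
        ∑ p ∈ Nat.primesLE x, if p ∣ t ^ 2 + 1 then Real.log ((p : ℕ) : ℝ) else 0 := by
    intro t _
    rw [← Finset.sum_filter]
    refine Finset.sum_congr ?_ fun _ _ => rfl
    ext p
    simp only [Finset.mem_filter, Nat.mem_primeFactors, Nat.mem_primesLE]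
    have hn : t ^ 2 + 1 ≠ 0 := Nat.succ_ne_zero _
    tauto
  rw [Finset.sum_congr rfl hinner, Finset.sum_comm]
  refine Finset.sum_congr rfl fun p _ => ?_
  rw [← Finset.sum_filter, Finset.sum_const, nsmul_eq_mul, mul_comm]

/-- Block count (the trivial remainder estimate, tree: `Iwaniec1978.abs_rem_le_rho`):
`#{1 ≤ t ≤ x : d ∣ t²+1} ≥ ρ(d)·x/d − ρ(d)`. [folklore] -/
theorem isogenyRedei_wallLemma_rho_mul_div_sub_le_card (x : ℕ) {d : ℕ} (hd : d ≠ 0) :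
    (rho d : ℝ) * x / d - rho d ≤
      (((Finset.Icc 1 x).filter fun t : ℕ => d ∣ t ^ 2 + 1).card : ℝ) := by
  have h1 := (abs_le.mp (abs_rem_le_rho (x := (x : ℝ)) (Nat.cast_nonneg x) hd)).1
  simp only [rem, congrCount, Nat.floor_natCast] at h1
  linarith

/-- **Chebyshev–Markov lower bound for the total smooth log-mass**: there is `C` with
`x log x − C·x ≤ Σ_{1 ≤ t ≤ x} s_x(t)` for all `x ≥ 1` (Mertens' theorem for `ρ`,
tree `Iwaniec1978.RhoMertensStrong_holds`; `ρ(p) ≤ 2`; Chebyshev `θ(x) ≤ x log 4`). [folklore] -/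
theorem isogenyRedei_wallLemma_sum_smoothLogMass_ge :
    ∃ C : ℝ, ∀ x : ℕ, 1 ≤ x →
      (x : ℝ) * Real.log x - C * x ≤
        ∑ t ∈ Finset.Icc 1 x,
          ∑ p ∈ (t ^ 2 + 1).primeFactors.filter (· ≤ x), Real.log ((p : ℕ) : ℝ) := by
  obtain ⟨C₀, hC₀⟩ := RhoMertensStrong_holds
  refine ⟨C₀ + 2 * Real.log 4, fun x hx => ?_⟩
  have hx' : (1 : ℝ) ≤ x := by exact_mod_cast hx
  rw [isogenyRedei_wallLemma_sum_smoothLogMass_eq]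
  have hterm : ∀ p ∈ Nat.primesLE x, Real.log ((p : ℕ) : ℝ) * ((rho p : ℝ) * x / p - rho p) ≤
      Real.log ((p : ℕ) : ℝ) * (((Finset.Icc 1 x).filter fun t : ℕ => p ∣ t ^ 2 + 1).card : ℝ) :=
    fun p hp => mul_le_mul_of_nonneg_left
      (isogenyRedei_wallLemma_rho_mul_div_sub_le_card x (Nat.prime_of_mem_primesLE hp).ne_zero)
      (Real.log_nonneg (by exact_mod_cast (Nat.prime_of_mem_primesLE hp).one_le))
  refine le_trans ?_ (Finset.sum_le_sum hterm)
  have hsplit : ∑ p ∈ Nat.primesLE x, Real.log ((p : ℕ) : ℝ) * ((rho p : ℝ) * x / p - rho p) =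
      (x : ℝ) * rhoLogSum x - ∑ p ∈ Nat.primesLE x, (rho p : ℝ) * Real.log p := by
    simp only [rhoLogSum, Nat.floor_natCast, Finset.mul_sum, ← Finset.sum_sub_distrib]
    refine Finset.sum_congr rfl fun p _ => ?_
    ring
  rw [hsplit]
  have hM : Real.log x - C₀ ≤ rhoLogSum x := by linarith [(abs_le.mp (hC₀ x hx')).1]
  have hθ : ∑ p ∈ Nat.primesLE x, (rho p : ℝ) * Real.log p ≤ 2 * (Real.log 4 * x) := by
    have h2 : ∀ p ∈ Nat.primesLE x, (rho p : ℝ) * Real.log p ≤ 2 * Real.log p := fun p hp =>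
      mul_le_mul_of_nonneg_right (by exact_mod_cast rho_le_two (Nat.prime_of_mem_primesLE hp))
        (Real.log_nonneg (by exact_mod_cast (Nat.prime_of_mem_primesLE hp).one_le))
    refine (Finset.sum_le_sum h2).trans ?_
    rw [← Finset.mul_sum, ← Chebyshev.theta_eq_sum_primesLE_log]
    exact mul_le_mul_of_nonneg_left (Chebyshev.theta_le_log4_mul_x (Nat.cast_nonneg x))
      (by norm_num)
  have hxnn : (0 : ℝ) ≤ x := by linarith
  have hM' : (x : ℝ) * (Real.log x - C₀) ≤ x * rhoLogSum x := mul_le_mul_of_nonneg_left hM hxnn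
  linarith

/-- `log(t² + 1) ≤ 2 log x + log 2` for `0 ≤ t ≤ x` and `x ≥ 1` (as `t² + 1 ≤ 2x²`). [folklore] -/
theorem isogenyRedei_wallLemma_log_sq_add_one_le {x t : ℕ} (hx : 1 ≤ x) (htx : t ≤ x) :
    Real.log ((t : ℝ) ^ 2 + 1) ≤ 2 * Real.log x + Real.log 2 := by
  have hx' : (1 : ℝ) ≤ x := by exact_mod_cast hx
  have htx' : (t : ℝ) ≤ x := by exact_mod_cast htx
  have h1 : (t : ℝ) ^ 2 + 1 ≤ 2 * (x : ℝ) ^ 2 := by nlinarith [Nat.cast_nonneg (α := ℝ) t]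
  have h2 : Real.log ((t : ℝ) ^ 2 + 1) ≤ Real.log (2 * (x : ℝ) ^ 2) :=
    Real.log_le_log (by positivity) h1
  rw [Real.log_mul (by norm_num) (by positivity), Real.log_pow] at h2
  push_cast at h2
  linarith

/-- **Chebyshev's counting lemma.** There is `C` such that for every real `ε`, every `x ≥ 1` and
every set `B` of integers `1 ≤ t ≤ x` each of which has small smooth log-mass
`s_x(t) ≤ (1−ε) log x + log 2`, one has `#B·(1+ε)·log x ≤ x log x + C·x`. [folklore] -/
theorem isogenyRedei_wallLemma_card_deficient_le :
    ∃ C : ℝ, ∀ ε : ℝ, ∀ x : ℕ, 1 ≤ x → ∀ B ⊆ Finset.Icc 1 x,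
      (∀ t ∈ B, ∑ p ∈ (t ^ 2 + 1).primeFactors.filter (· ≤ x), Real.log ((p : ℕ) : ℝ) ≤
          (1 - ε) * Real.log x + Real.log 2) →
        (B.card : ℝ) * ((1 + ε) * Real.log x) ≤ (x : ℝ) * Real.log x + C * x := by
  obtain ⟨C, hC⟩ := isogenyRedei_wallLemma_sum_smoothLogMass_ge
  refine ⟨C + Real.log 2, fun ε x hx B hB hdef => ?_⟩
  have hx' : (1 : ℝ) ≤ x := by exact_mod_cast hx
  have hlow := hC x hx
  set s : ℕ → ℝ := fun t => ∑ p ∈ (t ^ 2 + 1).primeFactors.filter (· ≤ x), Real.log ((p : ℕ) : ℝ) with hs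
  have hsplit : ∑ t ∈ Finset.Icc 1 x, s t = ∑ t ∈ B, s t + ∑ t ∈ Finset.Icc 1 x \ B, s t := by
    rw [← Finset.sum_union Finset.disjoint_sdiff, Finset.union_sdiff_of_subset hB]
  have hB' : ∑ t ∈ B, s t ≤ (B.card : ℝ) * ((1 - ε) * Real.log x + Real.log 2) := by
    have h := Finset.sum_le_sum hdef
    rw [Finset.sum_const, nsmul_eq_mul] at h
    exact h
  have hall : ∀ t ∈ Finset.Icc 1 x \ B, s t ≤ 2 * Real.log x + Real.log 2 := by
    intro t ht
    have ht' := Finset.mem_Icc.mp (Finset.mem_sdiff.mp ht).1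
    exact (isogenyRedei_wallLemma_smoothLogMass_le_log x t).trans
      (isogenyRedei_wallLemma_log_sq_add_one_le hx ht'.2)
  have hcomp : ∑ t ∈ Finset.Icc 1 x \ B, s t ≤
      ((Finset.Icc 1 x \ B).card : ℝ) * (2 * Real.log x + Real.log 2) := by
    have h := Finset.sum_le_sum hall
    rw [Finset.sum_const, nsmul_eq_mul] at h
    exact h
  have hBx : B.card ≤ x := by simpa using Finset.card_le_card hB
  have hcardc : ((Finset.Icc 1 x \ B).card : ℝ) = x - B.card := by
    rw [Finset.card_sdiff_of_subset hB, Nat.card_Icc, Nat.add_sub_cancel, Nat.cast_sub hBx]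
  have hlogx : 0 ≤ Real.log x := Real.log_nonneg hx'
  have key : (x : ℝ) * Real.log x - C * x ≤
      (B.card : ℝ) * ((1 - ε) * Real.log x + Real.log 2) +
        ((x : ℝ) - B.card) * (2 * Real.log x + Real.log 2) := by
    calc (x : ℝ) * Real.log x - C * x ≤ ∑ t ∈ Finset.Icc 1 x, s t := hlow
      _ = ∑ t ∈ B, s t + ∑ t ∈ Finset.Icc 1 x \ B, s t := hsplit
      _ ≤ (B.card : ℝ) * ((1 - ε) * Real.log x + Real.log 2) +
            ((Finset.Icc 1 x \ B).card : ℝ) * (2 * Real.log x + Real.log 2) :=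
          add_le_add hB' hcomp
      _ = _ := by rw [hcardc]
  linarith

/-- **The Chebyshev–Hooley class bound** (route IsogenyRedei, quantitative kernel of the informal
support `WallLemma`, stmt-Parity-11618): for every `ε > 0` there is `C` such that for all `x ≥ 2`,
`#{1 ≤ t ≤ x : some prime p ∣ t² + 1 has p > x^{1+ε}} ≤ x/(1+ε) + C·x/log x`.
(Chebyshev 1895 / Markov; Hooley 1967 §2.) [folklore] -/
theorem isogenyRedei_wallLemma_card_largePrimeFactor_le (ε : ℝ) (hε : 0 < ε) :
    ∃ C : ℝ, ∀ x : ℕ, 2 ≤ x →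
      ((((Finset.Icc 1 x).filter fun t : ℕ =>
          ∃ p : ℕ, p ∈ (t ^ 2 + 1).primeFactors ∧ (x : ℝ) ^ (1 + ε) < p).card : ℝ)) ≤
        (x : ℝ) / (1 + ε) + C * x / Real.log x := by
  obtain ⟨C, hC⟩ := isogenyRedei_wallLemma_card_deficient_le
  refine ⟨C / (1 + ε), fun x hx => ?_⟩
  set B := (Finset.Icc 1 x).filter fun t : ℕ =>
    ∃ p : ℕ, p ∈ (t ^ 2 + 1).primeFactors ∧ (x : ℝ) ^ (1 + ε) < p with hBdef
  have hx1 : (1 : ℝ) < x := by exact_mod_cast hx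
  have hx1' : (1 : ℝ) ≤ x := hx1.le
  have hxpos : (0 : ℝ) < x := by linarith
  have hlogx : 0 < Real.log x := Real.log_pos hx1
  have hdef : ∀ t ∈ B, ∑ p ∈ (t ^ 2 + 1).primeFactors.filter (· ≤ x), Real.log ((p : ℕ) : ℝ) ≤
      (1 - ε) * Real.log x + Real.log 2 := by
    intro t ht
    obtain ⟨ht1, q, hq, hxq⟩ := Finset.mem_filter.mp ht
    have hxle : (x : ℝ) ≤ (x : ℝ) ^ (1 + ε) := Real.self_le_rpow_of_one_le hx1' (by linarith)
    have hxq' : x < q := by exact_mod_cast hxle.trans_lt hxq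
    refine (isogenyRedei_wallLemma_smoothLogMass_le_of_large_prime hq hxq').trans ?_
    have hq0 : (0 : ℝ) < (x : ℝ) ^ (1 + ε) := by positivity
    have h1 : (1 + ε) * Real.log x < Real.log q := by
      rw [← Real.log_rpow hxpos]
      exact Real.log_lt_log hq0 hxq
    have h2 := isogenyRedei_wallLemma_log_sq_add_one_le (by omega : 1 ≤ x) (Finset.mem_Icc.mp ht1).2
    linarith
  have h := hC ε x (by omega) B (Finset.filter_subset _ _) hdef
  have hpos : 0 < (1 + ε) * Real.log x := by positivity
  rw [← le_div_iff₀ hpos] at h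
  refine h.trans (le_of_eq ?_)
  field_simp

/-- **Friable values at level `x^{1+ε}` have lower density at least `ε/(1+ε)`**: for every
`ε, δ > 0`, eventually `(ε/(1+ε) − δ)·x ≤ #{1 ≤ t ≤ x : every prime factor of t²+1 is ≤ x^{1+ε}}`.
[folklore] -/
theorem isogenyRedei_wallLemma_friable_density_ge (ε : ℝ) (hε : 0 < ε) (δ : ℝ) (hδ : 0 < δ) :
    ∀ᶠ x : ℕ in atTop, (ε / (1 + ε) - δ) * (x : ℝ) ≤
      (((Finset.Icc 1 x).filter fun t : ℕ =>
        ∀ p : ℕ, p ∈ (t ^ 2 + 1).primeFactors → (p : ℝ) ≤ (x : ℝ) ^ (1 + ε)).card : ℝ) := by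
  obtain ⟨C, hC⟩ := isogenyRedei_wallLemma_card_largePrimeFactor_le ε hε
  have hlim : Tendsto (fun x : ℕ => C / Real.log x) atTop (𝓝 0) :=
    tendsto_const_nhds.div_atTop (Real.tendsto_log_atTop.comp tendsto_natCast_atTop_atTop)
  have hev : ∀ᶠ x : ℕ in atTop, C / Real.log x < δ := hlim.eventually (Iio_mem_nhds hδ)
  filter_upwards [hev, eventually_ge_atTop 2] with x hCδ hx
  have hxpos : (0 : ℝ) < x := by exact_mod_cast (by omega : 0 < x)
  have hlogx : 0 < Real.log x := Real.log_pos (by exact_mod_cast hx)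
  set P : ℕ → Prop := fun t => ∀ p : ℕ, p ∈ (t ^ 2 + 1).primeFactors → (p : ℝ) ≤ (x : ℝ) ^ (1 + ε)
    with hP
  have hpart := Finset.card_filter_add_card_filter_not (s := Finset.Icc 1 x) P
  have hneg : ((Finset.Icc 1 x).filter fun t => ¬ P t) =
      (Finset.Icc 1 x).filter fun t : ℕ =>
        ∃ p : ℕ, p ∈ (t ^ 2 + 1).primeFactors ∧ (x : ℝ) ^ (1 + ε) < p := by
    refine Finset.filter_congr fun t _ => ?_
    simp only [hP, not_forall, not_le, exists_prop]
  rw [hneg, Nat.card_Icc, Nat.add_sub_cancel] at hpart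
  have hB := hC x hx
  have hcard : ((((Finset.Icc 1 x).filter P).card : ℕ) : ℝ) =
      (x : ℝ) - (((Finset.Icc 1 x).filter fun t : ℕ =>
        ∃ p : ℕ, p ∈ (t ^ 2 + 1).primeFactors ∧ (x : ℝ) ^ (1 + ε) < p).card : ℝ) := by
    have h := congrArg (fun n : ℕ => (n : ℝ)) hpart
    push_cast at h
    linarith
  rw [hcard]
  have h1 : C * x / Real.log x = C / Real.log x * x := by ring
  have h2 : C / Real.log x * x ≤ δ * x := mul_le_mul_of_nonneg_right hCδ.le hxpos.le
  have h1ε : (1 + ε : ℝ) ≠ 0 := by positivity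
  have h3 : (x : ℝ) - x / (1 + ε) = ε / (1 + ε) * x := by field_simp; ring
  nlinarith [hB, h1, h2, h3]

/-- **Dominant-free values of `t² + 1` have lower density at least `ε/(1+ε)`** (route IsogenyRedei,
the unconditional kernel of the informal support `WallLemma`, stmt-Parity-11618, with Chebyshev's
constant): for every `ε, δ > 0`, eventually
`(ε/(1+ε) − δ)·x ≤ #{1 ≤ t ≤ x : every prime p ∣ t² + 1 has p·x^{1-ε} < t² + 1}`.
A value that is NOT dominant-free and has `t² + 1 > x^{2-ε}` has a prime factor
`q ≥ (t²+1)·x^{ε-1} > x` and smooth log-mass `≤ (1−ε) log x`, so Chebyshev's counting lemma applies;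
the values `t² + 1 ≤ x^{2-ε}` number at most `x^{1-ε/2} = o(x)`. [folklore] -/
theorem isogenyRedei_wallLemma_dominantFree_density_ge (ε : ℝ) (hε : 0 < ε) (δ : ℝ) (hδ : 0 < δ) :
    ∀ᶠ x : ℕ in atTop, (ε / (1 + ε) - δ) * (x : ℝ) ≤
      (((Finset.Icc 1 x).filter fun t : ℕ =>
        ∀ p : ℕ, p ∈ (t ^ 2 + 1).primeFactors →
          (p : ℝ) * (x : ℝ) ^ (1 - ε) < (t : ℝ) ^ 2 + 1).card : ℝ) := by
  obtain ⟨C, hC⟩ := isogenyRedei_wallLemma_card_deficient_le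
  have hlim1 : Tendsto (fun x : ℕ => C / ((1 + ε) * Real.log x)) atTop (𝓝 0) :=
    tendsto_const_nhds.div_atTop
      ((Real.tendsto_log_atTop.comp tendsto_natCast_atTop_atTop).const_mul_atTop (by positivity))
  have hev1 : ∀ᶠ x : ℕ in atTop, C / ((1 + ε) * Real.log x) < δ / 2 :=
    hlim1.eventually (Iio_mem_nhds (by positivity))
  have hlim2 : Tendsto (fun x : ℕ => (x : ℝ) ^ (-(ε / 2))) atTop (𝓝 0) :=
    (tendsto_rpow_neg_atTop (by positivity : 0 < ε / 2)).comp tendsto_natCast_atTop_atTop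
  have hev2 : ∀ᶠ x : ℕ in atTop, (x : ℝ) ^ (-(ε / 2)) < δ / 4 :=
    hlim2.eventually (Iio_mem_nhds (by positivity))
  filter_upwards [hev1, hev2, eventually_ge_atTop 2] with x hCδ hxε hx
  have hxpos : (0 : ℝ) < x := by exact_mod_cast (by omega : 0 < x)
  have hx1 : (1 : ℝ) < x := by exact_mod_cast hx
  have hlogx : 0 < Real.log x := Real.log_pos hx1
  set F := (Finset.Icc 1 x).filter fun t : ℕ =>
    ∀ p : ℕ, p ∈ (t ^ 2 + 1).primeFactors → (p : ℝ) * (x : ℝ) ^ (1 - ε) < (t : ℝ) ^ 2 + 1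
    with hF
  set B := (Finset.Icc 1 x).filter fun t : ℕ =>
    (x : ℝ) ^ (2 - ε) < (t : ℝ) ^ 2 + 1 ∧
      ∃ p : ℕ, p ∈ (t ^ 2 + 1).primeFactors ∧ (t : ℝ) ^ 2 + 1 ≤ (p : ℝ) * (x : ℝ) ^ (1 - ε)
    with hB
  set Sm := (Finset.Icc 1 x).filter fun t : ℕ => (t : ℝ) ^ 2 + 1 ≤ (x : ℝ) ^ (2 - ε) with hSm
  have hcover : Finset.Icc 1 x ⊆ F ∪ (B ∪ Sm) := by
    intro t ht
    rw [Finset.mem_union, Finset.mem_union]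
    by_cases hFt : t ∈ F
    · exact Or.inl hFt
    · right
      have hnot : ∃ p : ℕ, p ∈ (t ^ 2 + 1).primeFactors ∧
          (t : ℝ) ^ 2 + 1 ≤ (p : ℝ) * (x : ℝ) ^ (1 - ε) := by
        by_contra hcon
        push Not at hcon
        exact hFt (Finset.mem_filter.mpr ⟨ht, hcon⟩)
      by_cases hbig : (x : ℝ) ^ (2 - ε) < (t : ℝ) ^ 2 + 1
      · exact Or.inl (Finset.mem_filter.mpr ⟨ht, hbig, hnot⟩)
      · exact Or.inr (Finset.mem_filter.mpr ⟨ht, not_lt.mp hbig⟩)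
  have hdef : ∀ t ∈ B, ∑ p ∈ (t ^ 2 + 1).primeFactors.filter (· ≤ x), Real.log ((p : ℕ) : ℝ) ≤
      (1 - ε) * Real.log x + Real.log 2 := by
    intro t ht
    obtain ⟨_, hbig, q, hq, hdom⟩ := Finset.mem_filter.mp ht
    have hqpos : (0 : ℝ) < q := by exact_mod_cast (Nat.prime_of_mem_primeFactors hq).pos
    have hx1ε : (0 : ℝ) < (x : ℝ) ^ (1 - ε) := Real.rpow_pos_of_pos hxpos _
    have hsplit : (x : ℝ) ^ (2 - ε) = x * (x : ℝ) ^ (1 - ε) := by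
      rw [show (2 - ε : ℝ) = 1 + (1 - ε) by ring, Real.rpow_add hxpos, Real.rpow_one]
    have hxq : (x : ℝ) < q := by
      by_contra hle
      push Not at hle
      have h : (q : ℝ) * (x : ℝ) ^ (1 - ε) ≤ x * (x : ℝ) ^ (1 - ε) :=
        mul_le_mul_of_nonneg_right hle hx1ε.le
      linarith
    have hxq' : x < q := by exact_mod_cast hxq
    refine (isogenyRedei_wallLemma_smoothLogMass_le_of_large_prime hq hxq').trans ?_
    have ht0 : (0 : ℝ) < (t : ℝ) ^ 2 + 1 := by positivity
    have h1 : Real.log ((t : ℝ) ^ 2 + 1) ≤ Real.log q + (1 - ε) * Real.log x := by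
      have h := Real.log_le_log ht0 hdom
      rwa [Real.log_mul hqpos.ne' hx1ε.ne', Real.log_rpow hxpos] at h
    have hlog2 : (0 : ℝ) ≤ Real.log 2 := Real.log_nonneg (by norm_num)
    linarith
  have hBle := hC ε x (by omega) B (Finset.filter_subset _ _) hdef
  have hpos : 0 < (1 + ε) * Real.log x := by positivity
  have hBle' : (B.card : ℝ) ≤ x / (1 + ε) + C / ((1 + ε) * Real.log x) * x := by
    rw [← le_div_iff₀ hpos] at hBle
    refine hBle.trans (le_of_eq ?_)
    field_simp
  have hSmle : (Sm.card : ℝ) ≤ (x : ℝ) ^ (1 - ε / 2) := by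
    have hsub : Sm ⊆ Finset.Icc 1 ⌊(x : ℝ) ^ (1 - ε / 2)⌋₊ := by
      intro t ht
      obtain ⟨ht1, hsm⟩ := Finset.mem_filter.mp ht
      rw [Finset.mem_Icc] at ht1 ⊢
      refine ⟨ht1.1, Nat.le_floor ?_⟩
      have ht0 : (0 : ℝ) ≤ t := Nat.cast_nonneg t
      have hy0 : (0 : ℝ) ≤ (x : ℝ) ^ (1 - ε / 2) := Real.rpow_nonneg hxpos.le _
      have hsq : ((x : ℝ) ^ (1 - ε / 2)) ^ 2 = (x : ℝ) ^ (2 - ε) := by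
        rw [← Real.rpow_natCast, ← Real.rpow_mul hxpos.le]
        congr 1
        push_cast
        ring
      have h2 : (t : ℝ) ^ 2 ≤ ((x : ℝ) ^ (1 - ε / 2)) ^ 2 := by rw [hsq]; linarith
      exact (pow_le_pow_iff_left₀ ht0 hy0 two_ne_zero).mp h2
    calc (Sm.card : ℝ) ≤ ((Finset.Icc 1 ⌊(x : ℝ) ^ (1 - ε / 2)⌋₊).card : ℝ) := by
          exact_mod_cast Finset.card_le_card hsub
      _ = ⌊(x : ℝ) ^ (1 - ε / 2)⌋₊ := by rw [Nat.card_Icc, Nat.add_sub_cancel]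
      _ ≤ (x : ℝ) ^ (1 - ε / 2) := Nat.floor_le (Real.rpow_nonneg hxpos.le _)
  have hSm' : (Sm.card : ℝ) ≤ δ / 4 * x := by
    have heq : (x : ℝ) ^ (1 - ε / 2) = x * (x : ℝ) ^ (-(ε / 2)) := by
      rw [show (1 - ε / 2 : ℝ) = 1 + -(ε / 2) by ring, Real.rpow_add hxpos, Real.rpow_one]
    have h : (x : ℝ) * (x : ℝ) ^ (-(ε / 2)) ≤ x * (δ / 4) :=
      mul_le_mul_of_nonneg_left hxε.le hxpos.le
    linarith [hSmle]
  have hcard : (x : ℝ) ≤ F.card + (B.card + Sm.card) := by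
    have h := (Finset.card_le_card hcover).trans
      ((Finset.card_union_le _ _).trans (Nat.add_le_add_left (Finset.card_union_le _ _) _))
    rw [Nat.card_Icc, Nat.add_sub_cancel] at h
    exact_mod_cast h
  have hCx : C / ((1 + ε) * Real.log x) * x ≤ δ / 2 * x :=
    mul_le_mul_of_nonneg_right hCδ.le hxpos.le
  have h1ε : (1 + ε : ℝ) ≠ 0 := by positivity
  have h3 : (x : ℝ) - x / (1 + ε) = ε / (1 + ε) * x := by field_simp; ring
  linarith [hcard, hBle', hSm', hCx, h3]

end Summit.Parity.BatemanHorn.Theorems
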